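import Summits.Parity.GeneralizedHardyLittlewood.Theorems.BeyondDiagonalBeatsQuarter.OffDiagDualCostBoxIntegral
import HarnessLib

/-!
# Route `PrimeLevelFamEdge`, crux K_B (stmt-Parity-20343), line `diagonal_kernel_split` rev 4, plan Ω,
# lemma L2c (derivative costs), step 8: **the `t₂`-derivatives of the box weight by symmetry**

d5's box weight is symmetric under the swap `(y₁, d₁, α, i₁) ↔ (y₂, d₂, β, i₂)`:
`boxWeight q d₁ d₂ α β r i y₁ y₂ = boxWeight q d₂ d₁ β α r i.swap y₂ y₁` (`boxWeight_swap`). Hence the pure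
`t₂`-derivative cost of `Φ_i` is the pure `t₁`-derivative cost of the swapped box weight, already bounded in
`OffDiagDualCostBoxIntegral`:

* **`integral_norm_iteratedDeriv_boxWeight_snd_le_cost`** — for `q, d₁, d₂, α, β ≥ 1`, every box `i` and `m`:
  `∫dt₁∫dt₂ ‖∂₂ᵐΦ_i(t₁,t₂)‖ ≤ S'·D'ᵐ` with the constants of step 7 for the swapped data
  (`D' = (1+Z)/(K₂/2)`, `K₂ = 2^{i₂}`).

With step 7 (`A¹_k`, `A¹_{2k}`) and this file (`A²₄`), all three cost inputs of
`tsum_tail_norm_fourier2_le_pure_of_cost` (`OffDiagDualTruncationPure`) are available for `Φ_i`; the `h₂`-tail is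
the same statement for the swapped weight (`fourier2_transpose_of_contDiff`). Folklore, PROVED; theorems only.
Helper; closes nothing. «The programme SEARCHES and TYPES; no claim about Landau–Siegel zeros, Theorems 1–2 of
arXiv:2211.02515 or a repaired Margin232 until a kernel theorem says so.»
-/

noncomputable section

open Real Set Finset MeasureTheory
open scoped Topology ContDiff Nat

namespace Summit.Parity.GeneralizedHardyLittlewood.Theorems.BeyondDiagonalBeatsQuarter.OffDiagPoissonTwisted

open Literature.Analysis.FunctionSpaces Literature.NumberTheory.LFunctions.KMV2000
open Literature.Analysis.Calculus.WhitneyConvex (dyadicBump dyadicBumpBound)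
open OffDiag (boxWeight layerWeightR)

section Swap

variable {q d₁ d₂ α β r : ℕ}

/-- **Symmetry of the box weight**: `Φ_{(i₁,i₂)}[d₁,d₂,α,β](y₁,y₂) = Φ_{(i₂,i₁)}[d₂,d₁,β,α](y₂,y₁)`. [folklore] -/
theorem boxWeight_swap (i : ℕ × ℕ) (y₁ y₂ : ℝ) :
    boxWeight q d₁ d₂ α β r i y₁ y₂ = boxWeight q d₂ d₁ β α r i.swap y₂ y₁ := by
  simp only [boxWeight, layerWeightR, Prod.fst_swap, Prod.snd_swap]
  have h1 : (d₁ : ℝ) * y₁ * ((d₂ : ℝ) * y₂) = (d₂ : ℝ) * y₂ * ((d₁ : ℝ) * y₁) := by ring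
  have h2 : (α : ℝ) * y₁ * ((β : ℝ) * y₂) = (β : ℝ) * y₂ * ((α : ℝ) * y₁) := by ring
  rw [h1, h2, mul_comm (dyadicBump (y₁ / 2 ^ i.1)) (dyadicBump (y₂ / 2 ^ i.2))]

/-- The `t₂`-slice of `Φ_i` through `t₁` is the `t₁`-slice of the swapped box weight. [folklore] -/
theorem boxWeight_slice_snd_eq (i : ℕ × ℕ) (t₁ : ℝ) :
    boxWeight q d₁ d₂ α β r i t₁ = fun s : ℝ => boxWeight q d₂ d₁ β α r i.swap s t₁ := by
  funext s
  exact boxWeight_swap i t₁ s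

/-- **The pure `t₂`-derivative cost of the box weight** (step 7 for the swapped data): for
`q, d₁, d₂, α, β ≥ 1`, a box `i` and every `m`,
`∫dt₁∫dt₂‖∂₂ᵐΦ_i(t₁,t₂)‖ ≤ S'·((1+Z')/(K₂/2))ᵐ` with the swapped constants of
`integral_norm_iteratedDeriv_boxWeight_le_cost`. [folklore] -/
theorem integral_norm_iteratedDeriv_boxWeight_snd_le_cost [NeZero q] (hd₁ : 1 ≤ d₁) (hd₂ : 1 ≤ d₂)
    (hα : 1 ≤ α) (hβ : 1 ≤ β) (i : ℕ × ℕ) (m : ℕ) :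
    (∫ t₁, ∫ t₂, ‖iteratedDeriv m (boxWeight q d₁ d₂ α β r i t₁) t₂‖) ≤
      ((3 * 2 ^ i.1 / 2) * (3 * 2 ^ i.2 / 2) *
        (∑ j ∈ Finset.range (m + 1), (m.choose j : ℝ) * (2 ^ j * dyadicBumpBound j) *
          ((((m - j : ℕ) : ℝ) + 1) ^ 2 * (m - j) ! * ((m - j : ℕ) : ℝ) ^ (m - j))) *
        (((d₂ : ℝ) * d₁ * (2 ^ i.1 / 2)) ^ (-(1 : ℝ) / 2) * (r : ℝ)⁻¹ * ((2 : ℝ) ^ i.2 / 2) ^ (-(1 : ℝ) / 2))) *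
      ((1 + 4 * π * Real.sqrt ((β : ℝ) * α * (2 * 2 ^ i.1)) / ((q : ℝ) * r) * Real.sqrt (2 * 2 ^ i.2)) /
        ((2 : ℝ) ^ i.2 / 2)) ^ m := by
  have h := integral_norm_iteratedDeriv_boxWeight_le_cost (q := q) (r := r) hd₂ hd₁ hβ hα i.swap m
  simp only [Prod.fst_swap, Prod.snd_swap] at h
  have hfun : ∀ t₁ : ℝ, (fun t₂ : ℝ => ‖iteratedDeriv m (boxWeight q d₁ d₂ α β r i t₁) t₂‖) =
      fun t₂ : ℝ => ‖iteratedDeriv m (fun s : ℝ => boxWeight q d₂ d₁ β α r i.swap s t₁) t₂‖ := by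
    intro t₁; funext t₂; rw [boxWeight_slice_snd_eq]
  simp_rw [hfun]
  exact h

end Swap

end Summit.Parity.GeneralizedHardyLittlewood.Theorems.BeyondDiagonalBeatsQuarter.OffDiagPoissonTwisted
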